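import Literature.MathematicalPhysics.QuantumFieldTheory.BalabanImbrieJaffe1984to88.BIJ88Expansion5143
import Literature.MathematicalPhysics.QuantumFieldTheory.BalabanImbrieJaffe1984to88.BIJ88PolymerRep5134Gauss
import Mathlib.Analysis.Calculus.IteratedDeriv.Lemmas
import Mathlib.Analysis.Calculus.Deriv.Mul

/-!
# `BalabanImbrieJaffe1984to88.BIJ88Expansion5143Gauss` — T. Bałaban, J. Imbrie, A. Jaffe, *Effective action and cluster properties of the
abelian Higgs model*, Commun. Math. Phys. **114** (1988) 257–315 [BalabanImbrieJaffe1988], §5.14 pp. 308–309 [PDF 52–53]: **the device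
*"We express each d/dt as a sum Σ_γ (d/dt)_γ"* as a theorem (the iterated derivative of a finite product is the sum over the ASSIGNMENTS of
the derivative slots to the factors), and display (5.14.3) FOR THE GAUSSIAN MEASURES of §5.13** — the MODEL INSTANCE of the slot-local,
cluster-factorizing corner expectations of `BIJ88Expansion5143` built, in the finite-dimensional Gaussian model of this seat's gen-8 file
`BIJ88PolymerRep5134Gauss`, from per-term derivative factors `u_τ^{(m)}` (the `(d/dt)_γ`-factors of p. 308).

statement-level skeleton of published theorems with citation tags; proofs where landed; nothing here is a claim about the Yang–Mills mass gap

PDF held: `paper:balaban1988-cmp114-bij-abelian-higgs-effective-action` (journal page = PDF page + 256); p. 308 = PDF 52 rendered and read as an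
image (`renders/original-p052-x2.png` of the p25 seat), p. 309 = PDF 53 (`lit-balaban-ref-1/renders/cmp114/original-p053-x2.png`).

**The print (verbatim, p. 308 [PDF 52]).** *"Here ⟨·⟩_t is the interacting expectation ⟨·⟩_t = (1/z_t(Λ₁₂^{(k)})) ⟨· χ′_{Λ₁₂^{(k)},t}
e^{−tṼ^{(k)}₁₂(Λ^{(k)})}⟩_{1,Λ₁₂^{(k)}}, with χ′_{Λ₁₂^{(k)},t} defined as above replacing p(e_k) with p(te_k). We express each d/dt as a sum Σ_γ (d/dt)_γ,
where (d/dt)_γ acts only on the t before a particular term V^{(k)}(Y) in Ṽ^{(k)} or in a particular χ-factor. We cluster expand as before each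
integral making up the truncated expectation values ⟨(d/dt)_{γ_1}; …; (d/dt)_{γ_{n̄+1}}⟩_t."* p. 309 [PDF 53]: *"⟨Π_{j∈H} (d/dt)_{γ_j} χ′_{Λ^{(k)}_{12},t}
e^{−tṼ^{(k)}(Λ^{(k)}_{12})}⟩_{1,Λ^{(k)}_{12}} = Σ_{{X_α} filling Λ^{(k)}_{12}} Π_β g₃(H_β, X_β). (5.14.3)"*

WHAT IS REPRODUCED (unit `lit-balaban-p25`, generation 10 of the Phase-2 proof seat p25; SKELETON row `C2.Eq5.14.3-5.14.4` of
`HOME/lit-balaban-r16/ROWS-C2-part2.md`; HOME `run/shared/lean/pub/lit-balaban/`).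
* §1 **`d/dt = Σ_γ (d/dt)_γ`**: for a finite family of factors `U τ : ℝ → ℝ` (the `χ`-factors and the `e^{−tV(Y)}`, indexed by a finite type
  `T` of TERMS) all of whose iterated derivatives are differentiable, `mult γ τ` = the number of derivative slots the assignment `γ : Fin n → T`
  puts on the term `τ`, and **`iteratedDeriv_prod_eq_sum_assignments`**: `(d/dt)ⁿ Π_τ U_τ = Σ_{γ : Fin n → T} Π_τ U_τ^{(mult γ τ)}` — the
  multinomial Leibniz rule in the assignment form the paper uses (each `γ_l` names the term the `l`-th `d/dt` acts on); `mult_cons`,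
  `iteratedDeriv_prod_eq_sum_assignments_apply`, and `…_of_contDiff` (smooth factors).
* §2 THE GAUSSIAN SLOT-LOCAL DATA: in the model of `BIJ88PolymerRep5134Gauss` (sites `α`, cubes `I`, `blk : α → I`, precision `Δ` coupling only
  abutting cubes (`hΔ`), linear term `ℱ`), a slot-indexed family of cube observables `fS K i` with `fS K i = fS (K ∩ loc⁻¹ i) i` (`hS`) gives corner
  expectations `zG (fS K)` that are SLOT-LOCAL (`isSlotLocal_zG`, via `expect_congr`) and cluster-factorizing (gen 8); the DERIVATIVE OBSERVABLES
  `fD u cube γ K i φ := Π_{τ : cube τ = i} u τ (#{j ∈ K : γ j = τ}) φ` — in cube `□_i`, the product over the terms located there of the factor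
  differentiated as many times as `K` assigns slots to it (*"(d/dt)_γ acts only on the t before a particular term"*; `u τ m` = the `m`-th
  `t`-derivative of the term `τ` as a function of the field, `cube τ`-local, `hu`) — satisfy both (`fD_local`, `fD_slot`, `loc = cube ∘ γ`).
* §3 **(5.14.3) FOR THESE GAUSSIAN EXPECTATIONS**: **`expansion5143_gauss`** — `⟨Π_{i∈W} fD K i⟩_{1,W} = Σ_{P admissible filling of W} Π_{X∈P}
  g₃(H(X), X)` with `g₃ = BIJ88Expansion5143.g3` of the data `K ↦ zG (fD K)` and `H(X) = slotsIn (cube ∘ γ) K X`; and without the filling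
  condition, prime dropped (`expansion5143_gauss_dropPrime`).

**Honest scope.** Real scalar fields on finitely many sites (the paper's `Φ = (A″, φ″)` with the `δ_{Ax}` constraints is a finite-dimensional
Gaussian on a product of per-cube subspaces — not modelled, as in gen 8); `t`, the `γ_j`, the cut-off profiles are parameters of the factors `u`;
the `m`-th derivative factors are supplied abstractly (`u τ m`) — §1 is what identifies `Π_{j∈K}(d/dt)_{γ_j}` of the product of the undifferentiated
factors with the product of the `u τ (mult)`, pointwise in the field; no bound ((5.14.4) is the typed leaf `Ineq5144`); the interchange of `d/dt`
with the Gaussian integral is p36's `BIJ88RestrictionsAllOrders308` and is not used here. 0 `sorry`, 0 new `Prop` facts; imports `BIJ88Expansion5143`,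
`BIJ88PolymerRep5134Gauss`, Mathlib calculus; modifies nothing. NOT summit progress; NOT continuum; NOT Clay. Cell `lit-balaban` Phase 2, seat p25
gen 10; row C2.Eq5.14.3-5.14.4 (owner r16, referee ref-5).
-/

noncomputable section

open Finset
open scoped BigOperators ContDiff
open Literature.Probability.LatticeModels (IsSetPartition setPartitions mem_setPartitions)
open Literature.MathematicalPhysics.QuantumFieldTheory.BalabanImbrieJaffe1984to88.BIJ88Clusters5134 (IsClusterFactorizing)
open Literature.MathematicalPhysics.QuantumFieldTheory.BalabanImbrieJaffe1984to88.BIJ88PolymerRep5134 (IsAdmissible corner)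
open Literature.MathematicalPhysics.QuantumFieldTheory.BalabanImbrieJaffe1984to88.BIJ88PolymerRep5134Gauss
  (ext obs zG isClusterFactorizing_zG)
open Literature.MathematicalPhysics.QuantumFieldTheory.BalabanImbrieJaffe1984to88.BIJ88Expansion5143

namespace Literature.MathematicalPhysics.QuantumFieldTheory.BalabanImbrieJaffe1984to88.BIJ88Expansion5143Gauss

/-! ## §1 *"We express each d/dt as a sum Σ_γ (d/dt)_γ"*: the iterated derivative of a product as a sum over slot assignments -/

section Leibniz

variable {T : Type*} [DecidableEq T]

/-- the number of derivative slots the assignment `γ` puts on the term `τ` (the order of `(d/dt)_τ` in `Π_l (d/dt)_{γ_l}`).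
[cite: BalabanImbrieJaffe1988, p.308 (Sect. 5.14)] -/
def mult {n : ℕ} (γ : Fin n → T) (τ : T) : ℕ := (univ.filter fun l => γ l = τ).card

/-- no derivative, no slot on any term. [cite: BalabanImbrieJaffe1988, p.308 (Sect. 5.14)] -/
theorem mult_zero (γ : Fin 0 → T) (τ : T) : mult γ τ = 0 := by
  simp [mult]

/-- one more derivative acting on the term `τ₀`: the multiplicities of `cons τ₀ γ`. [cite: BalabanImbrieJaffe1988, p.308 (Sect. 5.14)] -/
theorem mult_cons {n : ℕ} (τ₀ : T) (γ : Fin n → T) (τ : T) :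
    mult (Fin.cons τ₀ γ : Fin (n + 1) → T) τ = mult γ τ + if τ₀ = τ then 1 else 0 := by
  simp only [mult, card_filter, Fin.sum_univ_succ, Fin.cons_zero, Fin.cons_succ]
  rw [add_comm]

variable [Fintype T] (U : T → ℝ → ℝ)

/-- **`d/dt = Σ_γ (d/dt)_γ`, ITERATED** (p. 308 [PDF 52], verbatim: *"We express each d/dt as a sum Σ_γ (d/dt)_γ, where (d/dt)_γ acts only on the
t before a particular term V^{(k)}(Y) in Ṽ^{(k)} or in a particular χ-factor"*): for factors all of whose iterated derivatives are differentiable,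
`(d/dt)ⁿ Π_τ U_τ = Σ_{γ : Fin n → T} Π_τ U_τ^{(mult γ τ)}` — the `n`-th derivative of the product is the sum over the assignments of the `n`
derivative slots to the terms of the product of the correspondingly differentiated factors (multinomial Leibniz rule in assignment form).
[cite: BalabanImbrieJaffe1988, p.308 (Sect. 5.14)] -/
theorem iteratedDeriv_prod_eq_sum_assignments (hU : ∀ τ (m : ℕ), Differentiable ℝ (iteratedDeriv m (U τ))) (n : ℕ) :
    iteratedDeriv n (fun t => ∏ τ, U τ t) = fun t => ∑ γ : Fin n → T, ∏ τ, iteratedDeriv (mult γ τ) (U τ) t := by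
  induction n with
  | zero =>
      funext t
      rw [iteratedDeriv_zero, Fintype.sum_unique]
      exact prod_congr rfl fun τ _ => by rw [mult_zero, iteratedDeriv_zero]
  | succ n ih =>
      funext t
      rw [iteratedDeriv_succ, ih]
      have hdiff : ∀ (γ : Fin n → T) (τ : T), DifferentiableAt ℝ (iteratedDeriv (mult γ τ) (U τ)) t := fun γ τ => (hU τ _).differentiableAt
      have hderiv : HasDerivAt (fun t => ∑ γ : Fin n → T, ∏ τ, iteratedDeriv (mult γ τ) (U τ) t)
          (∑ γ : Fin n → T, ∑ τ₀, (∏ τ ∈ univ.erase τ₀, iteratedDeriv (mult γ τ) (U τ) t) •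
            deriv (iteratedDeriv (mult γ τ₀) (U τ₀)) t) t :=
        HasDerivAt.fun_sum fun γ _ => HasDerivAt.fun_finsetProd fun τ _ => (hdiff γ τ).hasDerivAt
      rw [hderiv.deriv]
      -- right side: split the assignments of `n + 1` slots into the term of the first slot and the rest
      rw [← Fintype.sum_equiv (Fin.consEquiv fun _ => T) (fun p => ∏ τ, iteratedDeriv (mult (Fin.cons p.1 p.2 : Fin (n + 1) → T) τ) (U τ) t)
        (fun γ' => ∏ τ, iteratedDeriv (mult γ' τ) (U τ) t) fun p => rfl, Fintype.sum_prod_type]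
      conv_rhs => rw [sum_comm]
      refine sum_congr rfl fun γ _ => sum_congr rfl fun τ₀ _ => ?_
      dsimp only
      rw [smul_eq_mul, ← iteratedDeriv_succ]
      conv_rhs => rw [← prod_erase_mul univ _ (mem_univ τ₀)]
      rw [mult_cons, if_pos rfl]
      congr 1
      refine prod_congr rfl fun τ hτ => ?_
      rw [mult_cons, if_neg (ne_of_mem_erase hτ).symm, add_zero]

/-- the same, at a point. [cite: BalabanImbrieJaffe1988, p.308 (Sect. 5.14)] -/
theorem iteratedDeriv_prod_eq_sum_assignments_apply (hU : ∀ τ (m : ℕ), Differentiable ℝ (iteratedDeriv m (U τ))) (n : ℕ) (t : ℝ) :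
    iteratedDeriv n (fun t => ∏ τ, U τ t) t = ∑ γ : Fin n → T, ∏ τ, iteratedDeriv (mult γ τ) (U τ) t := by
  rw [iteratedDeriv_prod_eq_sum_assignments U hU n]

/-- the same for smooth factors. [cite: BalabanImbrieJaffe1988, p.308 (Sect. 5.14)] -/
theorem iteratedDeriv_prod_eq_sum_assignments_of_contDiff (hU : ∀ τ, ContDiff ℝ ∞ (U τ)) (n : ℕ) (t : ℝ) :
    iteratedDeriv n (fun t => ∏ τ, U τ t) t = ∑ γ : Fin n → T, ∏ τ, iteratedDeriv (mult γ τ) (U τ) t :=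
  iteratedDeriv_prod_eq_sum_assignments_apply U
    (fun τ m => (hU τ).differentiable_iteratedDeriv m (by exact_mod_cast ENat.coe_lt_top m)) n t

end Leibniz

/-! ## §2 Slot-local cube observables in the Gaussian model of `BIJ88PolymerRep5134Gauss` -/

section Gauss

variable {α I : Type} [Fintype α] [DecidableEq α] [Fintype I] [DecidableEq I] {S : Type*}
  (blk : α → I) (Δ : Matrix α α ℝ) (ℱ : α → ℝ) (loc : S → I)

/-- the Gaussian expectation over the fields of `X` depends on the observables only through the cubes of `X`.
[cite: BalabanImbrieJaffe1988, p.306 (Sect. 5.13)] -/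
theorem expect_congr {f f' : I → (α → ℝ) → ℝ} {X : Finset I} (h : ∀ i ∈ X, f i = f' i) (s : I → ℝ) :
    BIJ88PolymerRep5134Gauss.expect blk Δ ℱ f X s = BIJ88PolymerRep5134Gauss.expect blk Δ ℱ f' X s := by
  have hobs : obs blk f X = obs blk f' X := funext fun φ => prod_congr rfl fun i hi => by rw [h i hi]
  unfold BIJ88PolymerRep5134Gauss.expect
  rw [hobs]

/-- **SLOT-LOCALITY OF THE GAUSSIAN CORNER EXPECTATIONS**: if the observable of cube `□_i` for the slot set `K` depends only on the slots located
at `□_i` (`hS`), the corner expectations `K ↦ zG (fS K)` are slot-local in the sense of `BIJ88Expansion5143.IsSlotLocal` (*"⟨·⟩_{s_Γ,X} is defined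
by integrating over the fields in X only"* sees only the `(d/dt)_γ`-factors located in `X`). [cite: BalabanImbrieJaffe1988, (5.14.3) p.309] -/
theorem isSlotLocal_zG (fS : Finset S → I → (α → ℝ) → ℝ) (hS : ∀ K i, fS K i = fS (K.filter fun j => loc j = i) i) :
    IsSlotLocal loc (fun K => zG blk Δ ℱ (fS K)) := by
  intro K X Λ _
  refine expect_congr blk Δ ℱ (fun i hi => ?_) _
  rw [hS K i, hS (slotsIn loc K X) i]
  congr 1
  ext j
  simp only [mem_filter, mem_slotsIn]
  exact ⟨fun ⟨hjK, hji⟩ => ⟨⟨hjK, hji ▸ hi⟩, hji⟩, fun ⟨⟨hjK, _⟩, hji⟩ => ⟨hjK, hji⟩⟩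

variable {T : Type*} [Fintype T] [DecidableEq T] (u : T → ℕ → (α → ℝ) → ℝ) (cube : T → I) (γ : S → T)

/-- **the derivative observables of cube `□_i` for the slot set `K`** (p. 308: *"(d/dt)_γ acts only on the t before a particular term V^{(k)}(Y)
in Ṽ^{(k)} or in a particular χ-factor"*): the product over the terms `τ` located in `□_i` of the factor of `τ` differentiated as many times as
`K` assigns slots to `τ` — `u τ m` being the `m`-th `t`-derivative of the term `τ` as a function of the field (`t` a parameter).
[cite: BalabanImbrieJaffe1988, (5.14.3) p.309] -/
def fD (K : Finset S) (i : I) (φ : α → ℝ) : ℝ :=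
  ∏ τ ∈ univ.filter (fun τ => cube τ = i), u τ (K.filter fun j => γ j = τ).card φ

variable {u cube}

omit [Fintype α] [DecidableEq α] [Fintype I] in
/-- the derivative observables are cube-local when the factors are (`hu`: the term `τ` sees only the field in `□_{cube τ}`).
[cite: BalabanImbrieJaffe1988, (5.14.3) p.309] -/
theorem fD_local (hu : ∀ τ m (φ ψ : α → ℝ), (∀ x, blk x = cube τ → φ x = ψ x) → u τ m φ = u τ m ψ) (K : Finset S) (i : I) (φ ψ : α → ℝ)
    (h : ∀ x, blk x = i → φ x = ψ x) : fD u cube γ K i φ = fD u cube γ K i ψ := by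
  refine prod_congr rfl fun τ hτ => hu τ _ φ ψ fun x hx => h x ?_
  rw [hx, (mem_filter.1 hτ).2]

omit [Fintype α] [DecidableEq α] [Fintype I] in
variable (u cube) in
/-- the derivative observables of `□_i` see only the slots located at `□_i` (`loc = cube ∘ γ`). [cite: BalabanImbrieJaffe1988, (5.14.3) p.309] -/
theorem fD_slot (K : Finset S) (i : I) : fD u cube γ K i = fD u cube γ (K.filter fun j => cube (γ j) = i) i := by
  funext φ
  refine prod_congr rfl fun τ hτ => ?_
  have hτi : cube τ = i := (mem_filter.1 hτ).2
  congr 2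
  ext j
  simp only [mem_filter]
  exact ⟨fun ⟨hjK, hjτ⟩ => ⟨⟨hjK, hjτ ▸ hτi⟩, hjτ⟩, fun ⟨⟨hjK, _⟩, hjτ⟩ => ⟨hjK, hjτ⟩⟩

/-! ## §3 Display (5.14.3) for the Gaussian expectations of the derivative observables -/

/-- **DISPLAY (5.14.3) FOR THE GAUSSIAN MEASURES OF §5.13** (p. 309 [PDF 53]: *"⟨Π_{j∈H} (d/dt)_{γ_j} χ′_{Λ^{(k)}_{12},t} e^{−tṼ^{(k)}(Λ^{(k)}_{12})}
⟩_{1,Λ^{(k)}_{12}} = Σ_{{X_α} filling Λ^{(k)}_{12}} Π_β g₃(H_β, X_β). (5.14.3) Here H_β ⊂ H specifies which (d/dt)_{γ_j} have supports intersecting X_β"*)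
— MODEL INSTANCE: real fields on finitely many sites, weight `e^{−½⟨Φ,Δ_sΦ⟩}e^{⟨Φ,ℱ⟩}dΦ` with `Δ` coupling only abutting cubes (`hΔ`), the integrand
being the product over the cubes of `W` of the derivative observables `fD K i` (cube-local factors, `hu`): the Gaussian expectation
`⟨Π_{i∈W} fD K i⟩_{1,W}` equals the sum over the admissible fillings `{X_β}` of `W` (cluster configurations) of `Π_β g₃(H_β, X_β)`, `g₃` the printed
activity (corner form) of the data `K ↦ zG (fD K)`, `H_β = slotsIn (cube ∘ γ) K X_β`. [cite: BalabanImbrieJaffe1988, (5.14.3) p.309] -/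
theorem expansion5143_gauss (adj : I → I → Prop) [DecidableRel adj] (hΔ : ∀ x y, blk x ≠ blk y → ¬ adj (blk x) (blk y) → Δ x y = 0)
    (hu : ∀ τ m (φ ψ : α → ℝ), (∀ x, blk x = cube τ → φ x = ψ x) → u τ m φ = u τ m ψ) (K : Finset S) (W : Finset I) :
    BIJ88PolymerRep5134Gauss.expect blk Δ ℱ (fD u cube γ K) W (corner ℝ W) =
      ∑ P ∈ (setPartitions W).filter (IsAdmissible adj),
        ∏ X ∈ P, g3 adj (fun H => zG blk Δ ℱ (fD u cube γ H)) (slotsIn (cube ∘ γ) K X) X :=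
  expansion5143 (z := fun H => zG blk Δ ℱ (fD u cube γ H))
    (isClusterFactorizing_zG blk Δ ℱ (fD u cube γ K) adj hΔ (fD_local blk γ hu K))
    (isSlotLocal_zG blk Δ ℱ (cube ∘ γ) (fD u cube γ) fun H i => fD_slot u cube γ H i) W

/-- **… and without the filling condition, prime dropped** (p. 309: *"the above expansion holds again, but without the condition that {X_β}
fill Λ^{(k)}_{12}. The {X_β} must cover all cubes connected with the (d/dt)_{γ_j}, j ∈ H. Let us drop the prime"*), for slots located in `W`.
[cite: BalabanImbrieJaffe1988, (5.14.3) p.309] -/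
theorem expansion5143_gauss_dropPrime [DecidableEq S] (adj : I → I → Prop) [DecidableRel adj]
    (hΔ : ∀ x y, blk x ≠ blk y → ¬ adj (blk x) (blk y) → Δ x y = 0)
    (hu : ∀ τ m (φ ψ : α → ℝ), (∀ x, blk x = cube τ → φ x = ψ x) → u τ m φ = u τ m ψ) {K : Finset S} {W : Finset I}
    (hK : ∀ j ∈ K, cube (γ j) ∈ W) :
    BIJ88PolymerRep5134Gauss.expect blk Δ ℱ (fD u cube γ K) W (corner ℝ W) =
      ∑ F ∈ (nonoverlapping W).filter (fun F => IsAdmissible adj F ∧ Covers (cube ∘ γ) K F),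
        ∏ X ∈ F, prime (g3 adj (fun H => zG blk Δ ℱ (fD u cube γ H))) (slotsIn (cube ∘ γ) K X) X :=
  expansion5143_dropPrime (z := fun H => zG blk Δ ℱ (fD u cube γ H))
    (isClusterFactorizing_zG blk Δ ℱ (fD u cube γ K) adj hΔ (fD_local blk γ hu K))
    (isSlotLocal_zG blk Δ ℱ (cube ∘ γ) (fD u cube γ) fun H i => fD_slot u cube γ H i) hK

end Gauss

end Literature.MathematicalPhysics.QuantumFieldTheory.BalabanImbrieJaffe1984to88.BIJ88Expansion5143Gauss

end
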